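import Summits.BirchSwinnertonDyer.BirchSwinnertonDyer.Theorems.GenusKolyvaginAtTwoPowDvdShaCardAtTwoRTRankDescentLaws
import Summits.BirchSwinnertonDyer.BirchSwinnertonDyer.Theorems.GenusKolyvaginAtTwoPowDvdShaCardAtTwoRTRankDescentAlgebra
import Summits.BirchSwinnertonDyer.BirchSwinnertonDyer.Theorems.GenusKolyvaginAtTwoPowDvdShaCardAtTwoRTOrthogonalCapstoneFrame
import Summits.BirchSwinnertonDyer.BirchSwinnertonDyer.Theorems.GenusKolyvaginAtTwoPowDvdShaCardAtTwoRTNonPhantomPowHabitat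
import Summits.BirchSwinnertonDyer.BirchSwinnertonDyer.Theorems.Rank1ResidualJetRingClassFields
import Literature.NumberTheory.EllipticCurves.HeegnerPointsKolyvaginSelmerProofs
import Literature.NumberTheory.EllipticCurves.Rank1Residual.Typed.X5DescentSelmer
import HarnessLib

/-!
# Route `GenusKolyvaginAtTwo`, LINE 18 (L_T `PowDvdShaCardAtTwoRT`, stmt-BirchSwinnertonDyer-23659), road (E4), P-reduction —
# **`rank E(K) ≤ 1` ON L_T's HABITAT, UNCONDITIONALLY** (Kolyvagin's theorem, rank half, AT `2`, from Q2 + the tree)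

Seat `bsd-line-gk2-p4` g21 (WIDTH-5 attach, cell `bsd-f1-sign2`), `--supports stmt-BirchSwinnertonDyer-23659` (helper; closes nothing).
THEOREMS ONLY (no definition, no named fact, no `sorry`).  BSD is NOT proved by any of this; neither is L_T (this file is its last missing
arithmetic input on road (E4): the capstone `…RTOrthogonalCapstoneRankLeOne` takes `rank E(K) ≤ 1` where gk2-p2's took `PubInputsAtTwo`).

WHAT.  `mordellWeilRank_baseChange_le_one_onHabitat`: on L_T's frame — `E/ℚ` globally minimal, non-CM, odd Tamagawa product, an odd prime of
multiplicative reduction, `Δ < 0`, `ρ_{E,2^n}` onto for all `n`; `K` imaginary quadratic with `d_K` odd `≠ −3`, the Heegner hypothesis,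
`K ≠ ℚ(√Δ), ℚ(√−2|Δ|)`; a frame `(Dt, β, ι)` and a Kolyvagin–Heegner datum `d₁` of conductor `1` with `2^{M₀+1} ∤ P(1)` (the infinite
order of `P(1) = y_K` is not even needed: non-divisibility replaces it); Q2 `KolyvaginRelationAtTwo` by name — **`rank_ℤ E(K) ≤ 1`**.  No `PubInputsAtTwo`, no Gross–Zagier, no Literature
`kolyvagin`: the descent runs at `p = 2` inside the tree.

HOW (Gross 1991 §10 at level `2^M`, `M = 2M₀ + 5`, lossy bits allowed).  `δ = δ_{2^M} : E(K) → H¹(K, E[2^M])`, kernel `2^M E(K)`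
(`kummerMapTorsion_ker`); `y = c_M(1) = δ y_K` (`VisiblePairAtTwo.kolyvaginClass_one_two_eq_kummerMapTorsion`) has order `≥ 2^{M−M₀}`;
`q = δ Q₀` for `Q₀ ∉ 2E(K)` with `2^{n₀} Q₀ = y_K` (`n₀ ≤ M₀` maximal) has order `2^M`, sign `−w(E)` (Gross 5.3 transported, odd torsion dies)
and carries `y`; the laws (A), (B) of `…RTRankDescentLaws` ((NPh) from the multiplicative prime, `NonPhantomPow.nonPhantomAtTwo_of_hasMultiplicativeReductionAt`)
bound the `±`-eigenclasses of `Sel_{2^M}` by `2^{M₀+1}`; `…RTRankDescentAlgebra` turns them into `2^{M₀+2} • Sel ⊆ ⟨q⟩` and then into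
`rank ≤ 1` (`2(M₀+2) < M`).

References: [GrossLMS1991] §1 Thm. 1.3, §2, §10; [Kolyvagin1990] Thm. A; [McCallumLMS1991] §1, §3 Cor. 3.2, §5; [SilvermanAEC2009] VIII.§2.
-/

set_option autoImplicit false
-- the Theorems namespace of this sub repeats the summit name by design (D-0017 nested layout)
set_option linter.dupNamespace false

noncomputable section

open scoped Classical
open scoped AddSubgroup

namespace Summit.BirchSwinnertonDyer.BirchSwinnertonDyer.Theorems.GenusExact.PlusDescent

open WeierstrassCurve NumberField IsDedekindDomain Field Literature.NumberTheory.EllipticCurves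
  Literature.NumberTheory.GaloisRepresentations Literature.NumberTheory.EllipticCurves.ModularForms AddSubgroup
open Summit.BirchSwinnertonDyer.BirchSwinnertonDyer.Theses.GenusKolyvaginAtTwo (KolyvaginRelationAtTwo)
open Summit.BirchSwinnertonDyer.Rank1Residual

/-! ## §1 Two-power bookkeeping in a group without `2`-torsion -/

section NoTwoTorsion

variable {A : Type*} [AddCommGroup A]

/-- `2^M • R = 2^j • P` with `j ≤ M` and no `2`-torsion ⟹ `P = 2^{M−j} • R`. [folklore] -/
theorem eq_two_pow_zsmul_of_two_pow_zsmul_eq (h2 : ∀ a : A, (2 : ℤ) • a = 0 → a = 0) {j M : ℕ} (hjM : j ≤ M)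
    {P R : A} (h : ((2 ^ M : ℕ) : ℤ) • R = ((2 ^ j : ℕ) : ℤ) • P) : P = ((2 ^ (M - j) : ℕ) : ℤ) • R := by
  have hpow : ((2 ^ M : ℕ) : ℤ) = ((2 ^ j : ℕ) : ℤ) * ((2 ^ (M - j) : ℕ) : ℤ) := by
    push_cast
    rw [← pow_add, Nat.add_sub_cancel' hjM]
  have h0 : ((2 ^ j : ℕ) : ℤ) • (P - ((2 ^ (M - j) : ℕ) : ℤ) • R) = 0 := by
    rw [smul_sub, smul_smul, ← hpow, h, sub_self]
  exact sub_eq_zero.mp (eq_zero_of_two_pow_zsmul_eq_zero h2 j h0)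

/-- A multiple of a torsion element by a non-zero integer... conversely: if `n • t` has finite order and `n ≠ 0` then so has `t`. [folklore] -/
theorem isOfFinAddOrder_of_zsmul {t : A} {n : ℤ} (hn : n ≠ 0) (h : IsOfFinAddOrder (n • t)) : IsOfFinAddOrder t := by
  obtain ⟨k, hk0, hk⟩ := (isOfFinAddOrder_iff_zsmul_eq_zero).mp h
  rw [smul_smul] at hk
  exact (isOfFinAddOrder_iff_zsmul_eq_zero).mpr ⟨k * n, mul_ne_zero hk0 hn, hk⟩

end NoTwoTorsion

/-! ## §2 `rank E(K) ≤ 1` on L_T's habitat -/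

/-- **Kolyvagin's theorem, rank half, AT `2` on L_T's habitat: `rank_ℤ E(K) ≤ 1`** — from Q2 (`KolyvaginRelationAtTwo`) and tree
theorems only (see the module docstring for the frame and the mechanism).  This is the one arithmetic input the K-side capstone of road (E4)
takes beyond L_T's binders (`…RTOrthogonalCapstoneRankLeOne`, replacing the print bundle `PubInputsAtTwo`).
[cite: GrossLMS1991, §1 Thm. 1.3 (1), §10] [cite: Kolyvagin1990, Thm. A] [cite: McCallumLMS1991, §1 Theorem (Kolyvagin)] -/
theorem mordellWeilRank_baseChange_le_one_onHabitat (hQ2 : KolyvaginRelationAtTwo)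
    (W : WeierstrassCurve ℚ) [W.IsElliptic] [W.IsGloballyMinimal] [NeZero (W.conductorNorm ℤ)] (hcm : ¬ W.HasCM)
    (hT : Odd W.tamagawaProduct) (v : HeightOneSpectrum (𝓞 ℚ)) (h2v : ((2 : ℕ) : 𝓞 ℚ) ∉ v.asIdeal)
    (hNv : ((W.conductorNorm ℤ : ℕ) : 𝓞 ℚ) ∈ v.asIdeal) (hmult : W.HasMultiplicativeReductionAt v) (hneg : W.Δ < 0)
    (K : Type) [Field K] [NumberField K] (hIQ : IsImaginaryQuadratic K) (hodd : Odd (NumberField.discr K))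
    (h3 : NumberField.discr K ≠ -3) (hHe : SatisfiesHeegnerHypothesis (W.conductorNorm ℤ) K)
    (hsq1 : ¬ IsSquare ((NumberField.discr K : ℚ) * -|W.Δ|)) (hsq2 : ¬ IsSquare ((NumberField.discr K : ℚ) * (-(2 * |W.Δ|))))
    (hρ : ∀ n : ℕ, 0 < n → W.HasSurjectiveModNGaloisRep ((2 : ℤ) ^ n))
    (Dt : ModularParametrizationData W (W.conductorNorm ℤ)) (β : ℤ) (ι : K →+* ℂ) (d₁ : KolyvaginHeegnerData Dt β ι 1) (M₀ : ℕ)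
    (hndiv : ¬ ∃ Q : (W.baseChange (ringClassField K ι 1)).toAffine.Point, ((2 ^ (M₀ + 1) : ℕ) : ℤ) • Q = d₁.derivedPoint) :
    (W.baseChange K).mordellWeilRank ≤ 1 := by
  haveI : Fact (Nat.Prime 2) := ⟨Nat.prime_two⟩
  haveI : ∀ j : ℕ, NumberField (ringClassField K ι j) := JET.numberField_ringClassField K hIQ ι
  haveI hell : (W.baseChange K).IsElliptic := inferInstanceAs ((W.map (algebraMap ℚ K)).IsElliptic)
  haveI : Module.Finite ℤ (W.baseChange K).toAffine.Point := (W.baseChange K).module_finite_point_holds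
  -- ### numerics and currencies
  set M := 2 * M₀ + 5 with hMdef
  have hM : 1 ≤ M := by omega
  have hsurN : ∀ m : ℕ, W.HasSurjectiveModNGaloisRep ((2 ^ m : ℕ) : ℤ) :=
    MinimalTwinBSDTwo.forall_hasSurjectiveModNGaloisRep_two_pow_of_pos W hρ
  have hρN : ∀ m : ℕ, W.HasSurjectiveModNGaloisRep (2 ^ m : ℕ) := fun m ↦ by exact_mod_cast hsurN m
  have hsurj1 : W.HasSurjectiveModNGaloisRep ((2 : ℤ) ^ 1) := hρ 1 one_pos
  have hs2 : W.HasSurjectiveModNGaloisRep 2 := by simpa using hsurj1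
  have h2 : Module.finrank ℚ K = 2 := hIQ.1
  have hN : (W.conductorNorm ℤ) ≠ 0 := NeZero.ne _
  obtain ⟨τ, hτ, hττ⟩ := Literature.NumberTheory.EllipticCurves.exists_conj_of_isImaginaryQuadratic (K := K) hIQ
  have hw : -W.rootNumber = 1 ∨ -W.rootNumber = -1 := by
    rcases W.rootNumber_eq_one_or with h | h <;> simp [h]
  -- ### no `2`-torsion in `E(K)`; the Kummer map `δ` modulo `2^M`
  have h2tors : ∀ P : (W.baseChange K).toAffine.Point, (2 : ℤ) • P = 0 → P = 0 := fun P hP ↦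
    EigenClassesFinite.forall_zsmul_two_pow_baseChange_eq_zero_of_hasSurjectiveModNGaloisRep_two W K h2 hs2 1 P (by simpa using hP)
  have hn : ((2 ^ M : ℕ) : ℤ) ≠ 0 := by positivity
  have hdiv : ∀ P : geomPoints (W.baseChange K), ∃ Q : geomPoints (W.baseChange K), ((2 ^ M : ℕ) : ℤ) • Q = P :=
    (W.baseChange K).zsmul_geomPoints_surjective_of_charZero hn
  set δ := kummerMapTorsion (W.baseChange K) ((2 ^ M : ℕ) : ℤ) hdiv with hδ
  have hker : δ.ker = (zsmulAddGroupHom (α := (W.baseChange K).toAffine.Point) ((2 ^ M : ℕ) : ℤ)).range :=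
    kummerMapTorsion_ker (W.baseChange K) ((2 ^ M : ℕ) : ℤ) hdiv
  have hker' : ∀ P : (W.baseChange K).toAffine.Point, δ P = 0 →
      ∃ R : (W.baseChange K).toAffine.Point, ((2 ^ M : ℕ) : ℤ) • R = P := fun P hP ↦ by
    have h : P ∈ δ.ker := (AddMonoidHom.mem_ker).mpr hP
    rw [hker] at h
    exact h
  have hδSel : ∀ P, δ P ∈ selmerGroup (W.baseChange K) ((2 ^ M : ℕ) : ℤ) := fun P ↦
    WeierstrassCurve.kummerMapTorsion_mem_selmerGroup (W.baseChange K) _ hdiv P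
  -- ### the Heegner point `Ph ↦ P(1)`, its class `y = c_M(1) = δ Ph`, `2^{M₀+1} ∤ Ph`
  obtain ⟨Ph, hPh, hPhmap⟩ := AdditiveKoly.exists_isHeegnerPoint_map_eq_derivedPoint_one (W := W) (K := K) (Dt := Dt) (β := β)
    (ι := ι) hIQ hHe d₁
  have hc1 : d₁.kolyvaginClass Nat.prime_two M = δ Ph :=
    VisiblePairAtTwo.kolyvaginClass_one_two_eq_kummerMapTorsion W K hIQ hodd hHe hsurj1 M d₁ Ph hPhmap
  have hP₀ : ∀ Q : (W.baseChange K).toAffine.Point, ((2 ^ (M₀ + 1) : ℕ) : ℤ) • Q ≠ Ph :=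
    forall_two_pow_smul_ne_bottom_of_not_dvd_derivedPoint d₁ Ph hPhmap le_rfl hndiv
  -- ### `Q₀ ∉ 2E(K)` with `2^{n₀} Q₀ = Ph`
  obtain ⟨n₀, Q₀, hn₀, hQ₀, hQ₀2⟩ : ∃ (n₀ : ℕ) (Q₀ : (W.baseChange K).toAffine.Point), n₀ ≤ M₀ ∧ ((2 ^ n₀ : ℕ) : ℤ) • Q₀ = Ph ∧
      ∀ R : (W.baseChange K).toAffine.Point, (2 : ℤ) • R ≠ Q₀ := by
    let Pdiv : ℕ → Prop := fun n ↦ ∃ Q : (W.baseChange K).toAffine.Point, ((2 ^ n : ℕ) : ℤ) • Q = Ph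
    have hP0 : Pdiv 0 := ⟨Ph, by rw [pow_zero, Nat.cast_one, one_zsmul]⟩
    obtain ⟨Q₀, hQ₀⟩ : Pdiv (Nat.findGreatest Pdiv M₀) := Nat.findGreatest_spec (Nat.zero_le M₀) hP0
    refine ⟨Nat.findGreatest Pdiv M₀, Q₀, Nat.findGreatest_le M₀, hQ₀, fun R hR ↦ ?_⟩
    have hP : ((2 ^ (Nat.findGreatest Pdiv M₀ + 1) : ℕ) : ℤ) • R = Ph := by
      rw [pow_succ, Nat.cast_mul, mul_smul]
      have h2R : ((2 : ℕ) : ℤ) • R = Q₀ := by exact_mod_cast hR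
      rw [h2R, hQ₀]
    by_cases hlt : Nat.findGreatest Pdiv M₀ + 1 ≤ M₀
    · exact Nat.findGreatest_is_greatest (Nat.lt_succ_self _) hlt ⟨R, hP⟩
    · have heq : Nat.findGreatest Pdiv M₀ = M₀ := by have := Nat.findGreatest_le (P := Pdiv) M₀; omega
      rw [heq] at hP
      exact hP₀ R hP
  set q := δ Q₀ with hqdef
  have hyq : δ Ph ∈ zmultiples q := by
    rw [← hQ₀, map_zsmul]
    exact zsmul_mem (mem_zmultiples q) _
  -- ### orders: `ord q = 2^M`, `ord y = 2^κ` with `M − M₀ ≤ κ`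
  obtain ⟨mq, hmqM, hmq⟩ := exists_addOrderOf_galH1Torsion_eq_two_pow W K M q
  have hmq_eq : mq = M := by
    by_contra hne
    have hlt : mq < M := lt_of_le_of_ne hmqM hne
    have h0 : ((2 ^ mq : ℕ) : ℤ) • q = 0 := (two_pow_zsmul_eq_zero_iff_of_addOrderOf W K hmq mq).mpr le_rfl
    obtain ⟨R, hR⟩ := hker' _ (by rw [map_zsmul]; exact h0)
    have hQ : Q₀ = ((2 ^ (M - mq) : ℕ) : ℤ) • R := eq_two_pow_zsmul_of_two_pow_zsmul_eq h2tors hmqM hR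
    refine hQ₀2 (((2 ^ (M - mq - 1) : ℕ) : ℤ) • R) ?_
    rw [hQ, smul_smul]
    congr 1
    push_cast
    rw [← pow_succ']
    congr 1
    omega
  rw [hmq_eq] at hmq
  obtain ⟨κ, hκM, hκ⟩ := exists_addOrderOf_galH1Torsion_eq_two_pow W K M (δ Ph)
  have hκge : M - M₀ ≤ κ := by
    by_contra hlt'
    have h0 : ((2 ^ κ : ℕ) : ℤ) • δ Ph = 0 := (two_pow_zsmul_eq_zero_iff_of_addOrderOf W K hκ κ).mpr le_rfl
    obtain ⟨R, hR⟩ := hker' _ (by rw [map_zsmul]; exact h0)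
    have hPhR : Ph = ((2 ^ (M - κ) : ℕ) : ℤ) • R := eq_two_pow_zsmul_of_two_pow_zsmul_eq h2tors hκM hR
    refine hP₀ (((2 ^ (M - κ - (M₀ + 1)) : ℕ) : ℤ) • R) ?_
    rw [hPhR, smul_smul]
    congr 1
    push_cast
    rw [← pow_add]
    congr 1
    omega
  -- ### the sign of `q`: `τ_* q = −w(E) • q` (Gross 5.3 transported to `Q₀`; odd torsion dies under `δ`)
  set τm := WeierstrassCurve.Affine.Point.map (W' := W) (τ : K →ₐ[ℚ] K) with hτm
  have hτq : conjAct W τ ((2 ^ M : ℕ) : ℤ) q = (-W.rootNumber) • q := by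
    have hgross := X11b.KolyvaginBottom.isOfFinAddOrder_map_sub_neg_rootNumber_smul (W := W) hIQ hHe hPh τ hτ
    -- `t = τ Q₀ − (−w) Q₀` is torsion: `2^{n₀} t = τ Ph − (−w) Ph`
    have ht : IsOfFinAddOrder (τm Q₀ - (-W.rootNumber) • Q₀) := by
      refine isOfFinAddOrder_of_zsmul (n := ((2 ^ n₀ : ℕ) : ℤ)) (by positivity) ?_
      have heq : ((2 ^ n₀ : ℕ) : ℤ) • (τm Q₀ - (-W.rootNumber) • Q₀) = τm Ph - (-W.rootNumber) • Ph := by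
        rw [smul_sub, ← map_zsmul, hQ₀, smul_comm, hQ₀]
      rw [heq]
      exact hgross
    obtain ⟨R, hR⟩ := exists_zsmul_two_pow_eq_of_odd_addOrderOf (W.baseChange K) M
      (odd_addOrderOf_of_forall_two_smul_eq_zero (W.baseChange K) h2tors ht)
    have hδt : δ (τm Q₀ - (-W.rootNumber) • Q₀) = 0 := by
      have hmem : τm Q₀ - (-W.rootNumber) • Q₀ ∈ δ.ker := by
        rw [hker]
        exact ⟨R, hR⟩
      exact (AddMonoidHom.mem_ker).mp hmem
    rw [map_sub, map_zsmul, sub_eq_zero] at hδt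
    rw [hqdef, conjAct_kummerMapTorsion W τ _ hdiv Q₀, ← hτm, hδt]
  -- ### (NPh_M) from the multiplicative prime
  have hNPh : ∀ z : galH1Torsion (W.baseChange K) ((2 ^ M : ℕ) : ℤ),
      (∀ ρ ∈ torsionFixing (W.baseChange K) ((2 ^ M : ℕ) : ℤ), h1Eval (W.baseChange K) ((2 ^ M : ℕ) : ℤ) z ρ = 0) →
      (∀ w : HeightOneSpectrum (𝓞 K), z ∈ selmerLocalKer (W.baseChange K) (w.adicCompletion K) ((2 ^ M : ℕ) : ℤ)) → z = 0 :=
    fun z hz hzS ↦ NonPhantomPow.nonPhantomAtTwo_of_hasMultiplicativeReductionAt (W := W) (K := K) hT hρ hIQ hodd hsq1 hsq2 hN hHe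
      h2v hNv hmult M hM z hz (fun w _ ↦ hzS w)
  -- ### the two laws, as `2^{M₀+1}`-annihilation
  have hbound : ∀ s : galH1Torsion (W.baseChange K) ((2 ^ M : ℕ) : ℤ),
      addOrderOf s * addOrderOf (d₁.kolyvaginClass Nat.prime_two M) ∣ 2 ^ (M + 1) → ((2 ^ (M₀ + 1) : ℕ) : ℤ) • s = 0 := by
    intro s hs
    obtain ⟨a, -, ha⟩ := exists_addOrderOf_galH1Torsion_eq_two_pow W K M s
    rw [ha, hc1, hκ, ← pow_add, Nat.pow_dvd_pow_iff_le_right (by norm_num)] at hs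
    exact (two_pow_zsmul_eq_zero_iff_of_addOrderOf W K ha (M₀ + 1)).mpr (by omega)
  have hB : ∀ s ∈ selmerGroup (W.baseChange K) ((2 ^ M : ℕ) : ℤ),
      conjAct W τ ((2 ^ M : ℕ) : ℤ) s = (-(-W.rootNumber)) • s → ((2 ^ (M₀ + 1) : ℕ) : ℤ) • s = 0 := by
    intro s hs hτs
    rw [neg_neg] at hτs
    exact hbound s (addOrderOf_mul_addOrderOf_dvd_of_sign_rootNumber W K hQ2 hcm hρN hT hneg hIQ hodd h3 hHe hsq1 Dt β ι hM hτ hNPh d₁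
      s hs hτs)
  have hA : ∀ s ∈ selmerGroup (W.baseChange K) ((2 ^ M : ℕ) : ℤ),
      conjAct W τ ((2 ^ M : ℕ) : ℤ) s = (-W.rootNumber) • s → Disjoint (zmultiples s) (zmultiples q) →
      ((2 ^ (M₀ + 1) : ℕ) : ℤ) • s = 0 := by
    intro s hs hτs hdisj
    refine hbound s (addOrderOf_mul_addOrderOf_dvd_of_sign_neg_rootNumber_of_disjoint W K hQ2 hcm hρN hT hneg hIQ hodd h3 hHe hsq1
      Dt β ι hM hτ hNPh d₁ q (hδSel Q₀) hτq (by rw [hc1]; exact hyq) s hs hτs hdisj)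
  -- ### the algebra: `2^{M₀+2} • Sel ⊆ ⟨q⟩`, hence `rank ≤ 1`
  have hV : ∀ x : galH1Torsion (W.baseChange K) ((2 ^ M : ℕ) : ℤ), ((2 ^ M : ℕ) : ℤ) • x = 0 :=
    fun x ↦ zsmul_discreteH1_torsion ((2 ^ M : ℕ) : ℤ) x
  have hcyc := zsmul_mem_zmultiples_of_exponent_laws hV (conjAct W τ ((2 ^ M : ℕ) : ℤ))
    (fun x ↦ conjAct_conjAct_of_mul_self W hττ _ x) (selmerGroup (W.baseChange K) ((2 ^ M : ℕ) : ℤ))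
    (fun x hx ↦ conjAct_mem_selmerGroup W (fun w ↦ hIQ.2.isComplex w) τ _ hx) hw (hδSel Q₀) hmq hτq hB hA
  have hrank := finrank_le_one_of_zsmul_map_mem_zmultiples h2tors δ (M := M) (c := M₀ + 2) (by omega) hker q (hV q)
    (fun a ↦ hcyc (δ a) (hδSel a))
  exact hrank

end Summit.BirchSwinnertonDyer.BirchSwinnertonDyer.Theorems.GenusExact.PlusDescent

end
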